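import Summits.KontsevichZagierPeriods.KontsevichZagierPeriods.Theorems.RootDecompZetaThreeFrontierCellZetaFourP06

/-! # `RootDecompZetaThreeFrontierNBCSpanFourP01` — part 1/19 of the mechanical ≤400-line split of `nb_src.lean` (sha256 3cd085ddf38fe8ab…)
Source: decomp-kz lens-1 g13 NBCSpan_v2.lean @3ff67457 LEVEL 2 §N (Orlik–Solomon straightening in dimension 4 as a finite table: nbcSpan_four; critic CLEARED g6-20 l.1368); --supports stmt-KontsevichZagierPeriods-27141.
Split by census-1 g10 `gen/splitlean.py`: scopes re-opened with their `open`/`variable`/`set_option` context; mathematics and declaration order unchanged. -/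

/-! ## §N  LEVEL 2 — the NBC span property `NBCSpan` (Orlik–Solomon straightening in dimension 4, as a finite table):
every frame monomial `∏ₘ 1/(S m).form` (`S` a frame of `M_{0,7}` chords) is a `ℚ`-combination of the 120 no-broken-circuit
monomials `Mfun b` on `Δ₄`.  The 1001 four-subsets of the 14 chords: 120 NBC frames (identity), 312 broken frames (explicit
Arnold expansions, `field_simp; ring`), 569 dependent sets (an explicit integer relation among `𝟙, vec …`, by `decide`). -/

set_option linter.dupNamespace false
noncomputable section

namespace Summit.KontsevichZagierPeriods.KontsevichZagierPeriods.Cruxes.GZNormalFormWThree.GZLadder.CellZetaFour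

open Set MeasureTheory Finset
open Literature.NumberTheory.Transcendental
open Summit.KontsevichZagierPeriods.KontsevichZagierPeriods.Cruxes.GZNormalFormWThree.GZLadder.RungFour
open Summit.KontsevichZagierPeriods.KontsevichZagierPeriods.Cruxes.GZNormalFormWThree.GZLadder.RotFour (mem_simplex_four_iff)

set_option linter.unusedVariables false
set_option linter.style.longLine false
set_option linter.style.setOption false
set_option linter.unusedTactic false
set_option linter.unreachableTactic false

/-- the fourteen chords of `M_{0,7}` not through `∞`, in the fixed order `01 02 03 04 12 13 14 15 23 24 25 34 35 45` -/
def chordList : List (Chord 4) := [c01, c02, c03, c04, c12, c13, c14, c15, c23, c24, c25, c34, c35, c45]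

/-- the `n`-th chord -/
def ch (n : Fin 14) : Chord 4 := chordList.getD n c01

/-- Auxiliary step `ch_0` (§N): ch 0. [bookkeeping] -/
theorem ch_0 : ch 0 = c01 := rfl

/-- Auxiliary step `ch_1` (§N): ch 1. [bookkeeping] -/
theorem ch_1 : ch 1 = c02 := rfl

/-- Auxiliary step `ch_2` (§N): ch 2. [bookkeeping] -/
theorem ch_2 : ch 2 = c03 := rfl

/-- Auxiliary step `ch_3` (§N): ch 3. [bookkeeping] -/
theorem ch_3 : ch 3 = c04 := rfl

/-- Auxiliary step `ch_4` (§N): ch 4. [bookkeeping] -/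
theorem ch_4 : ch 4 = c12 := rfl

/-- Auxiliary step `ch_5` (§N): ch 5. [bookkeeping] -/
theorem ch_5 : ch 5 = c13 := rfl

/-- Auxiliary step `ch_6` (§N): ch 6. [bookkeeping] -/
theorem ch_6 : ch 6 = c14 := rfl

/-- Auxiliary step `ch_7` (§N): ch 7. [bookkeeping] -/
theorem ch_7 : ch 7 = c15 := rfl

/-- Auxiliary step `ch_8` (§N): ch 8. [bookkeeping] -/
theorem ch_8 : ch 8 = c23 := rfl

/-- Auxiliary step `ch_9` (§N): ch 9. [bookkeeping] -/
theorem ch_9 : ch 9 = c24 := rfl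

/-- Auxiliary step `ch_10` (§N): ch 10. [bookkeeping] -/
theorem ch_10 : ch 10 = c25 := rfl

/-- Auxiliary step `ch_11` (§N): ch 11. [bookkeeping] -/
theorem ch_11 : ch 11 = c34 := rfl

/-- Auxiliary step `ch_12` (§N): ch 12. [bookkeeping] -/
theorem ch_12 : ch 12 = c35 := rfl

/-- Auxiliary step `ch_13` (§N): ch 13. [bookkeeping] -/
theorem ch_13 : ch 13 = c45 := rfl

/-- every chord is one of the fourteen -/
theorem chord_cases (c : Chord 4) : ∃ n : Fin 14, c = ch n := by
  obtain ⟨i, j, hlt, hp⟩ := c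
  fin_cases i <;> fin_cases j <;>
    first
      | exact absurd hlt (by decide)
      | exact absurd hp (by decide)
      | exact ⟨0, rfl⟩
      | exact ⟨1, rfl⟩
      | exact ⟨2, rfl⟩
      | exact ⟨3, rfl⟩
      | exact ⟨4, rfl⟩
      | exact ⟨5, rfl⟩
      | exact ⟨6, rfl⟩
      | exact ⟨7, rfl⟩
      | exact ⟨8, rfl⟩
      | exact ⟨9, rfl⟩
      | exact ⟨10, rfl⟩
      | exact ⟨11, rfl⟩
      | exact ⟨12, rfl⟩
      | exact ⟨13, rfl⟩

/-- `Good S`: either `S` is not a frame, or its monomial is an NBC combination on `Δ₄` -/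
def Good (S : Fin 4 → Chord 4) : Prop :=
  ¬ IsFrame S ∨ ∃ u : Fin 120 → ℚ, ∀ t ∈ KZ.openOrderedSimplex 4, ∏ m, 1 / (S m).form t = ∑ b, (u b : ℝ) * Mfun b t

/-- a frame is an injective tuple of chords -/
theorem inj_of_isFrame {S : Fin 4 → Chord 4} (h : IsFrame S) : Function.Injective S :=
  IsFrame.injective h   -- (the landed prelude's `IsFrame.injective`; the monolith used dot-notation on `LinearIndependent`)

/-- the lift of a permutation of the four chords to the five rows `𝟙, vec (S 0), …, vec (S 3)` -/
def liftPerm (σ : Equiv.Perm (Fin 4)) : Fin 5 → Fin 5 := Fin.cons 0 fun m => (σ m).succ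

/-- Auxiliary step `liftPerm_zero` (§N): lift Perm zero. [bookkeeping] -/
theorem liftPerm_zero (σ : Equiv.Perm (Fin 4)) : liftPerm σ 0 = 0 := by simp [liftPerm]

/-- Auxiliary step `liftPerm_succ` (§N): lift Perm succ. [bookkeeping] -/
theorem liftPerm_succ (σ : Equiv.Perm (Fin 4)) (m : Fin 4) : liftPerm σ m.succ = (σ m).succ := by simp [liftPerm]

/-- Auxiliary step `liftPerm_injective` (§N): lift Perm injective. [bookkeeping] -/
theorem liftPerm_injective (σ : Equiv.Perm (Fin 4)) : Function.Injective (liftPerm σ) := by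
  intro i i' h
  rcases Fin.eq_zero_or_eq_succ i with rfl | ⟨m, rfl⟩ <;> rcases Fin.eq_zero_or_eq_succ i' with rfl | ⟨m', rfl⟩
  · rfl
  · rw [liftPerm_zero, liftPerm_succ] at h; exact absurd h.symm (Fin.succ_ne_zero _)
  · rw [liftPerm_zero, liftPerm_succ] at h; exact absurd h (Fin.succ_ne_zero _)
  · rw [liftPerm_succ, liftPerm_succ, Fin.succ_inj] at h; rw [σ.injective h]

/-- frames are stable under permuting the chords -/
theorem isFrame_perm {S : Fin 4 → Chord 4} (hS : IsFrame S) (σ : Equiv.Perm (Fin 4)) : IsFrame (fun m => S (σ m)) := by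
  unfold IsFrame at *
  have heq : (Fin.cons (fun _ : Fin (4 + 1) => (1 : ℚ)) (fun m => (S (σ m)).vec) : Fin (4 + 1) → Fin (4 + 1) → ℚ) =
      (Fin.cons (fun _ : Fin (4 + 1) => (1 : ℚ)) (fun m => (S m).vec)) ∘ liftPerm σ := by
    funext i
    rcases Fin.eq_zero_or_eq_succ i with rfl | ⟨m, rfl⟩
    · simp [liftPerm_zero]
    · simp [liftPerm_succ]
  rw [heq]
  exact hS.comp _ (liftPerm_injective σ)

/-- `Good` for a permuted frame gives the NBC expansion of the frame -/
theorem rep_of_good_perm {S : Fin 4 → Chord 4} (hS : IsFrame S) (σ : Equiv.Perm (Fin 4)) (h : Good (fun m => S (σ m))) :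
    ∃ u : Fin 120 → ℚ, ∀ t ∈ KZ.openOrderedSimplex 4, ∏ m, 1 / (S m).form t = ∑ b, (u b : ℝ) * Mfun b t := by
  rcases h with h | ⟨u, hu⟩
  · exact absurd (isFrame_perm hS σ) h
  · refine ⟨u, fun t ht => ?_⟩
    rw [← hu t ht]
    exact (Equiv.prod_comp σ (fun m => 1 / (S m).form t)).symm

/-- an explicit integer relation among the rows `𝟙, vec (S 0), …, vec (S 3)` refutes the frame property -/
theorem not_isFrame_of_rel (S : Fin 4 → Chord 4) (g : Fin 5 → ℤ) (hg : g ≠ 0)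
    (h : ∀ l : Fin 5, ∑ i, g i * consZ S i l = 0) : ¬ IsFrame S := by
  rw [IsFrame, Fintype.linearIndependent_iff]
  intro hli
  have hrow : ∀ i l, (Fin.cons (fun _ : Fin 5 => (1 : ℚ)) (fun m => (S m).vec) : Fin 5 → Fin 5 → ℚ) i l =
      (consZ S i l : ℚ) := by
    intro i l
    refine Fin.cases ?_ (fun m => ?_) i
    · simp [consZ]
    · simp [consZ, vec_eq_cast]
  have h0 := hli (fun i => (g i : ℚ)) (by
    funext l
    simp only [Finset.sum_apply, Pi.smul_apply, smul_eq_mul, hrow, Pi.zero_apply]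
    exact_mod_cast h l)
  exact hg (funext fun i => by exact_mod_cast h0 i)

/-- NBC frames are good (identity expansion) -/
theorem good_nbc (b : Fin 120) : Good (fr b) := by
  refine Or.inr ⟨Pi.single b 1, fun t ht => ?_⟩
  rw [Finset.sum_eq_single b (fun b' _ hb' => by simp [hb']) (by simp)]
  simp [Mfun]

/-- a list of (NBC index, coefficient) pairs as a function on `Δ₄` -/
def lsum (L : List (Fin 120 × ℚ)) (t : Fin 4 → ℝ) : ℝ := (L.map fun p => (p.2 : ℝ) * Mfun p.1 t).sum

/-- Auxiliary step `lsum_nil` (§N): lsum nil. [bookkeeping] -/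
theorem lsum_nil (t : Fin 4 → ℝ) : lsum [] t = 0 := rfl

/-- Auxiliary step `lsum_cons` (§N): lsum cons. [bookkeeping] -/
theorem lsum_cons (p : Fin 120 × ℚ) (L : List (Fin 120 × ℚ)) (t : Fin 4 → ℝ) :
    lsum (p :: L) t = (p.2 : ℝ) * Mfun p.1 t + lsum L t := rfl

/-- Auxiliary step `lsum_rep` (§N): lsum rep. [bookkeeping] -/
theorem lsum_rep (L : List (Fin 120 × ℚ)) : ∃ u : Fin 120 → ℚ, ∀ t, lsum L t = ∑ b, (u b : ℝ) * Mfun b t := by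
  induction L with
  | nil => exact ⟨fun _ => 0, fun t => by simp [lsum_nil]⟩
  | cons p L ih =>
    obtain ⟨u, hu⟩ := ih
    refine ⟨fun b => (if b = p.1 then p.2 else 0) + u b, fun t => ?_⟩
    rw [lsum_cons, hu t]
    simp only [Rat.cast_add, add_mul, Finset.sum_add_distrib]
    congr 1
    rw [Finset.sum_eq_single p.1 (fun b _ hb => by simp [hb]) (by simp)]
    simp

/-- a broken frame is good once its monomial is identified with an explicit NBC combination -/
theorem good_of_list (S : Fin 4 → Chord 4) (L : List (Fin 120 × ℚ))
    (h : ∀ t ∈ KZ.openOrderedSimplex 4, ∏ m, 1 / (S m).form t = lsum L t) : Good S := by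
  obtain ⟨u, hu⟩ := lsum_rep L
  exact Or.inr ⟨u, fun t ht => (h t ht).trans (hu t)⟩

/-! ### the table: one entry per increasing 4-tuple of chord indices -/

/-- Auxiliary step `tab_0_1_2_3` (§N): tab 0 1 2 3. [bookkeeping] -/
theorem tab_0_1_2_3 : Good ![c01, c02, c03, c04] := by have h := good_nbc 0; rwa [fr_0] at h

/-- Auxiliary step `tab_0_1_2_4` (§N): tab 0 1 2 4. [bookkeeping] -/
theorem tab_0_1_2_4 : Good ![c01, c02, c03, c12] := Or.inl (not_isFrame_of_rel _ ![0, 1, -1, 0, 1] (by decide) (by decide))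

/-- Auxiliary step `tab_0_1_2_5` (§N): tab 0 1 2 5. [bookkeeping] -/
theorem tab_0_1_2_5 : Good ![c01, c02, c03, c13] := Or.inl (not_isFrame_of_rel _ ![0, 1, 0, -1, 1] (by decide) (by decide))

/-- Auxiliary step `tab_0_1_2_6` (§N): tab 0 1 2 6. [bookkeeping] -/
theorem tab_0_1_2_6 : Good ![c01, c02, c03, c14] := by have h := good_nbc 1; rwa [fr_1] at h

/-- Auxiliary step `tab_0_1_2_7` (§N): tab 0 1 2 7. [bookkeeping] -/
theorem tab_0_1_2_7 : Good ![c01, c02, c03, c15] := Or.inl (not_isFrame_of_rel _ ![-1, 1, 0, 0, 1] (by decide) (by decide))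

/-- Auxiliary step `tab_0_1_2_8` (§N): tab 0 1 2 8. [bookkeeping] -/
theorem tab_0_1_2_8 : Good ![c01, c02, c03, c23] := Or.inl (not_isFrame_of_rel _ ![0, 0, 1, -1, 1] (by decide) (by decide))

/-- Auxiliary step `tab_0_1_2_9` (§N): tab 0 1 2 9. [bookkeeping] -/
theorem tab_0_1_2_9 : Good ![c01, c02, c03, c24] := by have h := good_nbc 2; rwa [fr_2] at h

/-- Auxiliary step `tab_0_1_2_10` (§N): tab 0 1 2 10. [bookkeeping] -/
theorem tab_0_1_2_10 : Good ![c01, c02, c03, c25] := Or.inl (not_isFrame_of_rel _ ![-1, 0, 1, 0, 1] (by decide) (by decide))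

/-- Auxiliary step `tab_0_1_2_11` (§N): tab 0 1 2 11. [bookkeeping] -/
theorem tab_0_1_2_11 : Good ![c01, c02, c03, c34] := by have h := good_nbc 3; rwa [fr_3] at h

/-- Auxiliary step `tab_0_1_2_12` (§N): tab 0 1 2 12. [bookkeeping] -/
theorem tab_0_1_2_12 : Good ![c01, c02, c03, c35] := Or.inl (not_isFrame_of_rel _ ![-1, 0, 0, 1, 1] (by decide) (by decide))

/-- Auxiliary step `tab_0_1_2_13` (§N): tab 0 1 2 13. [bookkeeping] -/
theorem tab_0_1_2_13 : Good ![c01, c02, c03, c45] := by have h := good_nbc 4; rwa [fr_4] at h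

/-- Auxiliary step `tab_0_1_3_4` (§N): tab 0 1 3 4. [bookkeeping] -/
theorem tab_0_1_3_4 : Good ![c01, c02, c04, c12] := Or.inl (not_isFrame_of_rel _ ![0, 1, -1, 0, 1] (by decide) (by decide))

/-- Auxiliary step `tab_0_1_3_5` (§N): tab 0 1 3 5. [bookkeeping] -/
theorem tab_0_1_3_5 : Good ![c01, c02, c04, c13] := by have h := good_nbc 5; rwa [fr_5] at h

/-- Auxiliary step `tab_0_1_3_6` (§N): tab 0 1 3 6. [bookkeeping] -/
theorem tab_0_1_3_6 : Good ![c01, c02, c04, c14] := Or.inl (not_isFrame_of_rel _ ![0, 1, 0, -1, 1] (by decide) (by decide))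

/-- Auxiliary step `tab_0_1_3_7` (§N): tab 0 1 3 7. [bookkeeping] -/
theorem tab_0_1_3_7 : Good ![c01, c02, c04, c15] := Or.inl (not_isFrame_of_rel _ ![-1, 1, 0, 0, 1] (by decide) (by decide))

/-- Auxiliary step `tab_0_1_3_8` (§N): tab 0 1 3 8. [bookkeeping] -/
theorem tab_0_1_3_8 : Good ![c01, c02, c04, c23] := by have h := good_nbc 6; rwa [fr_6] at h

/-- Auxiliary step `tab_0_1_3_9` (§N): tab 0 1 3 9. [bookkeeping] -/
theorem tab_0_1_3_9 : Good ![c01, c02, c04, c24] := Or.inl (not_isFrame_of_rel _ ![0, 0, 1, -1, 1] (by decide) (by decide))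

/-- Auxiliary step `tab_0_1_3_10` (§N): tab 0 1 3 10. [bookkeeping] -/
theorem tab_0_1_3_10 : Good ![c01, c02, c04, c25] := Or.inl (not_isFrame_of_rel _ ![-1, 0, 1, 0, 1] (by decide) (by decide))

/-- Auxiliary step `tab_0_1_3_11` (§N): tab 0 1 3 11. [bookkeeping] -/
theorem tab_0_1_3_11 : Good ![c01, c02, c04, c34] :=
  good_of_list _ [((0 : Fin 120), (-1 : ℚ)), ((3 : Fin 120), (1 : ℚ))] fun t ht => by
    obtain ⟨f0, f1, f2, f3, g0, g1, g2, g3, d01, d02, d03, d12, d13, d23⟩ := facts ht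
    simp only [lsum_cons, lsum_nil, Fin.prod_univ_four, Matrix.cons_val_zero, Matrix.cons_val_one, Matrix.head_cons, Matrix.cons_val_two, Matrix.tail_cons, Matrix.cons_val_three, form_c01, form_c02, form_c04, form_c34, Mfun_0, Mfun_3]
    push_cast
    field_simp
    ring

/-- Auxiliary step `tab_0_1_3_12` (§N): tab 0 1 3 12. [bookkeeping] -/
theorem tab_0_1_3_12 : Good ![c01, c02, c04, c35] := by have h := good_nbc 7; rwa [fr_7] at h

/-- Auxiliary step `tab_0_1_3_13` (§N): tab 0 1 3 13. [bookkeeping] -/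
theorem tab_0_1_3_13 : Good ![c01, c02, c04, c45] := Or.inl (not_isFrame_of_rel _ ![-1, 0, 0, 1, 1] (by decide) (by decide))

/-- Auxiliary step `tab_0_1_4_5` (§N): tab 0 1 4 5. [bookkeeping] -/
theorem tab_0_1_4_5 : Good ![c01, c02, c12, c13] := Or.inl (not_isFrame_of_rel _ ![0, 1, -1, 1, 0] (by decide) (by decide))

/-- Auxiliary step `tab_0_1_4_6` (§N): tab 0 1 4 6. [bookkeeping] -/
theorem tab_0_1_4_6 : Good ![c01, c02, c12, c14] := Or.inl (not_isFrame_of_rel _ ![0, 1, -1, 1, 0] (by decide) (by decide))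

/-- Auxiliary step `tab_0_1_4_7` (§N): tab 0 1 4 7. [bookkeeping] -/
theorem tab_0_1_4_7 : Good ![c01, c02, c12, c15] := Or.inl (not_isFrame_of_rel _ ![0, 1, -1, 1, 0] (by decide) (by decide))

/-- Auxiliary step `tab_0_1_4_8` (§N): tab 0 1 4 8. [bookkeeping] -/
theorem tab_0_1_4_8 : Good ![c01, c02, c12, c23] := Or.inl (not_isFrame_of_rel _ ![0, 1, -1, 1, 0] (by decide) (by decide))

/-- Auxiliary step `tab_0_1_4_9` (§N): tab 0 1 4 9. [bookkeeping] -/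
theorem tab_0_1_4_9 : Good ![c01, c02, c12, c24] := Or.inl (not_isFrame_of_rel _ ![0, 1, -1, 1, 0] (by decide) (by decide))

/-- Auxiliary step `tab_0_1_4_10` (§N): tab 0 1 4 10. [bookkeeping] -/
theorem tab_0_1_4_10 : Good ![c01, c02, c12, c25] := Or.inl (not_isFrame_of_rel _ ![0, 1, -1, 1, 0] (by decide) (by decide))

/-- Auxiliary step `tab_0_1_4_11` (§N): tab 0 1 4 11. [bookkeeping] -/
theorem tab_0_1_4_11 : Good ![c01, c02, c12, c34] := Or.inl (not_isFrame_of_rel _ ![0, 1, -1, 1, 0] (by decide) (by decide))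

/-- Auxiliary step `tab_0_1_4_12` (§N): tab 0 1 4 12. [bookkeeping] -/
theorem tab_0_1_4_12 : Good ![c01, c02, c12, c35] := Or.inl (not_isFrame_of_rel _ ![0, 1, -1, 1, 0] (by decide) (by decide))

/-- Auxiliary step `tab_0_1_4_13` (§N): tab 0 1 4 13. [bookkeeping] -/
theorem tab_0_1_4_13 : Good ![c01, c02, c12, c45] := Or.inl (not_isFrame_of_rel _ ![0, 1, -1, 1, 0] (by decide) (by decide))

/-- Auxiliary step `tab_0_1_5_6` (§N): tab 0 1 5 6. [bookkeeping] -/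
theorem tab_0_1_5_6 : Good ![c01, c02, c13, c14] := by have h := good_nbc 8; rwa [fr_8] at h

/-- Auxiliary step `tab_0_1_5_7` (§N): tab 0 1 5 7. [bookkeeping] -/
theorem tab_0_1_5_7 : Good ![c01, c02, c13, c15] := Or.inl (not_isFrame_of_rel _ ![-1, 1, 0, 0, 1] (by decide) (by decide))

/-- Auxiliary step `tab_0_1_5_8` (§N): tab 0 1 5 8. [bookkeeping] -/
theorem tab_0_1_5_8 : Good ![c01, c02, c13, c23] := Or.inl (not_isFrame_of_rel _ ![0, -1, 1, -1, 1] (by decide) (by decide))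

/-- Auxiliary step `tab_0_1_5_9` (§N): tab 0 1 5 9. [bookkeeping] -/
theorem tab_0_1_5_9 : Good ![c01, c02, c13, c24] := by have h := good_nbc 9; rwa [fr_9] at h

/-- Auxiliary step `tab_0_1_5_10` (§N): tab 0 1 5 10. [bookkeeping] -/
theorem tab_0_1_5_10 : Good ![c01, c02, c13, c25] := Or.inl (not_isFrame_of_rel _ ![-1, 0, 1, 0, 1] (by decide) (by decide))

/-- Auxiliary step `tab_0_1_5_11` (§N): tab 0 1 5 11. [bookkeeping] -/
theorem tab_0_1_5_11 : Good ![c01, c02, c13, c34] := by have h := good_nbc 10; rwa [fr_10] at h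

/-- Auxiliary step `tab_0_1_5_12` (§N): tab 0 1 5 12. [bookkeeping] -/
theorem tab_0_1_5_12 : Good ![c01, c02, c13, c35] := Or.inl (not_isFrame_of_rel _ ![-1, 1, 0, 1, 1] (by decide) (by decide))

/-- Auxiliary step `tab_0_1_5_13` (§N): tab 0 1 5 13. [bookkeeping] -/
theorem tab_0_1_5_13 : Good ![c01, c02, c13, c45] := by have h := good_nbc 11; rwa [fr_11] at h

/-- Auxiliary step `tab_0_1_6_7` (§N): tab 0 1 6 7. [bookkeeping] -/
theorem tab_0_1_6_7 : Good ![c01, c02, c14, c15] := Or.inl (not_isFrame_of_rel _ ![-1, 1, 0, 0, 1] (by decide) (by decide))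

/-- Auxiliary step `tab_0_1_6_8` (§N): tab 0 1 6 8. [bookkeeping] -/
theorem tab_0_1_6_8 : Good ![c01, c02, c14, c23] := by have h := good_nbc 12; rwa [fr_12] at h

/-- Auxiliary step `tab_0_1_6_9` (§N): tab 0 1 6 9. [bookkeeping] -/
theorem tab_0_1_6_9 : Good ![c01, c02, c14, c24] := Or.inl (not_isFrame_of_rel _ ![0, -1, 1, -1, 1] (by decide) (by decide))

/-- Auxiliary step `tab_0_1_6_10` (§N): tab 0 1 6 10. [bookkeeping] -/
theorem tab_0_1_6_10 : Good ![c01, c02, c14, c25] := Or.inl (not_isFrame_of_rel _ ![-1, 0, 1, 0, 1] (by decide) (by decide))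

/-- Auxiliary step `tab_0_1_6_11` (§N): tab 0 1 6 11. [bookkeeping] -/
theorem tab_0_1_6_11 : Good ![c01, c02, c14, c34] :=
  good_of_list _ [((8 : Fin 120), (-1 : ℚ)), ((10 : Fin 120), (1 : ℚ))] fun t ht => by
    obtain ⟨f0, f1, f2, f3, g0, g1, g2, g3, d01, d02, d03, d12, d13, d23⟩ := facts ht
    simp only [lsum_cons, lsum_nil, Fin.prod_univ_four, Matrix.cons_val_zero, Matrix.cons_val_one, Matrix.head_cons, Matrix.cons_val_two, Matrix.tail_cons, Matrix.cons_val_three, form_c01, form_c02, form_c14, form_c34, Mfun_8, Mfun_10]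
    push_cast
    field_simp
    ring

/-- Auxiliary step `tab_0_1_6_12` (§N): tab 0 1 6 12. [bookkeeping] -/
theorem tab_0_1_6_12 : Good ![c01, c02, c14, c35] := by have h := good_nbc 13; rwa [fr_13] at h

/-- Auxiliary step `tab_0_1_6_13` (§N): tab 0 1 6 13. [bookkeeping] -/
theorem tab_0_1_6_13 : Good ![c01, c02, c14, c45] := Or.inl (not_isFrame_of_rel _ ![-1, 1, 0, 1, 1] (by decide) (by decide))

end Summit.KontsevichZagierPeriods.KontsevichZagierPeriods.Cruxes.GZNormalFormWThree.GZLadder.CellZetaFour
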